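import Mathlib
import HarnessLib
import Summits.Ventures.LatticeQCDFlow.Scoring.SchwingerDysonPhi4Gibbs
import Summits.Ventures.LatticeQCDFlow.Scoring.AcceptanceMonitorConcentrationIntegral

/-!
# LatticeQCDFlow / Scoring — the lattice φ⁴ flow sampler: ceiling-free error bars for the
# all-pairs acceptance estimate and for the printed acceptance monitor, for ANY model density

HONEST FRAMING: exact (Metropolis-corrected) sampling algorithms for lattice gauge theory;
figures of merit are autocorrelation/cost numbers at stated couplings and volumes; no
continuum-physics claim.

Venture `LatticeQCDFlow` (cell pub-lqcd), sub-topic `Scoring`; FANOUT row 3 (`s0-u1-a`, S0-B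
implementation A, GEN-10).  NEW WORK of the cell (specialisation): row 3's general-space laws
`Scoring/AllPairsAcceptanceVariance` (the sharp ceiling-free envelope
`Var[Û] ≤ 4a(1 − a)/n + 2(1 − a²)/(n(n − 1)) ≤ (n + 1)/(n(n − 1))`) and
`Scoring/AcceptanceMonitorConcentrationIntegral` (the printed monitor), imported, instantiated for
row 2's lattice φ⁴ flow sampler in the vocabulary of `Scoring/SchwingerDysonPhi4Gibbs` /
`Exactness/IMHAcceptanceGeHalfESS` (`phi4Flow_meanAccept_ge_half_ESS`): sites `Fin (m + 1)`,
configurations `φ : Fin (m + 1) → ℝ` with Lebesgue reference measure, the φ⁴ Gibbs density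
`e^{−S} = gibbsWeight J λ` (`λ > 0`, any real coupling matrix `J`), target
`p = e^{−S}/Z`, `Z = ∫ e^{−S}`, ANY positive measurable model density `q̃` with `∫ q̃ = 1` (the
trained flow's push-forward density), `N ≥ 2` independent proposals `x_i` with law `q̃ dφ` on an
abstract probability space, importance ratios `w = p/q̃`, and
`a = acc = ∫∫ min(p(φ)q̃(φ′), p(φ′)q̃(φ)) dφ dφ′`.  NO weight ceiling; NO definition is introduced.

* `phi4Target_normalised` — `p ≥ 0` measurable integrable with `∫ p = 1` (`Z > 0`);
* **`phi4Flow_variance_allPairs_le`** — `Var[Û] ≤ (N + 1)/(N(N − 1))` for the all-pairs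
  estimate `Û = Σ_{i≠j} min(w(x_i), w(x_j))/(N(N − 1))`;
* **`phi4Flow_chebyshev_allPairs`** — `P(|Û − a| ≥ t) ≤ (N + 1)/(N(N − 1)t²)`;
* **`phi4Flow_accMonitor_concentration`** — if moreover `W₂ = ∫ (e^{−S}/q̃)e^{−S} < ∞` (a
  positive population ESS, the hypothesis of `phi4Flow_meanAccept_ge_half_ESS`): the printed
  monitor `acc_est = Σ_{i≠j} min(w_i, w_j)/((N − 1)Σ_i w_i)` misses `a` by `(t + s)/(1 − s)` or
  more with probability `≤ (N + 1)/(N(N − 1)t²) + (W₂/Z² − 1)/(N s²)` (`W₂/Z² − 1 = 1/ESS − 1`).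

Reading (value-free): for the φ⁴ flow at any checkpoint, whatever the network, the acceptance
read off `N` fresh proposals is certified at Chebyshev level with a flow-independent bar
`√((N + 1)/(N − 1))/√N`; the printed self-normalised monitor additionally needs only a lower bound
on the population ESS.  NOT CLAIMED: any acceptance, ESS or monitor value of ours; exponential
tails; gauge targets (row 3's general-space files apply verbatim once the densities are typed).
-/

namespace Summit.Ventures.LatticeQCDFlow.Scoring

open MeasureTheory ProbabilityTheory Finset

section Phi4

variable {Ω : Type*} [MeasurableSpace Ω] {P : Measure Ω} [IsProbabilityMeasure P] {m N : ℕ}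

/-- **The normalised φ⁴ target**: with `Z = ∫ e^{−S} > 0`, `p = e^{−S}/Z` is non-negative,
measurable, integrable and `∫ p = 1` (a positive normalised `q̃` certifies `volume ≠ 0`). [ours] -/
theorem phi4Target_normalised {lam : ℝ} (hlam : 0 < lam) (J : Fin (m + 1) → Fin (m + 1) → ℝ)
    {q : (Fin (m + 1) → ℝ) → ℝ} (hq1 : ∫ φ, q φ = 1) :
    0 < ∫ ψ, gibbsWeight J lam ψ ∧
    (∀ φ, 0 ≤ gibbsWeight J lam φ / ∫ ψ, gibbsWeight J lam ψ) ∧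
    Measurable (fun φ => gibbsWeight J lam φ / ∫ ψ, gibbsWeight J lam ψ) ∧
    Integrable (fun φ => gibbsWeight J lam φ / ∫ ψ, gibbsWeight J lam ψ) ∧
    ∫ φ, gibbsWeight J lam φ / ∫ ψ, gibbsWeight J lam ψ = 1 := by
  have hμ : (volume : Measure (Fin (m + 1) → ℝ)) ≠ 0 := by
    intro h
    have h1 := hq1
    rw [h, integral_zero_measure] at h1
    exact zero_ne_one h1
  have hZ : 0 < ∫ ψ, gibbsWeight J lam ψ := by
    rw [integral_pos_iff_support_of_nonneg (fun ψ => (gibbsWeight_pos J lam ψ).le)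
      (integrable_gibbsWeight hlam J)]
    have hsupp : Function.support (gibbsWeight J lam) = Set.univ :=
      Set.eq_univ_of_forall fun ψ => (gibbsWeight_pos J lam ψ).ne'
    rw [hsupp]
    exact Measure.measure_univ_pos.2 hμ
  refine ⟨hZ, fun φ => div_nonneg (gibbsWeight_pos J lam φ).le hZ.le,
    (continuous_gibbsWeight J lam).measurable.div_const _,
    (integrable_gibbsWeight hlam J).div_const _, ?_⟩
  rw [integral_div, div_self hZ.ne']

/-- **φ⁴ FLOW, ALL-PAIRS ACCEPTANCE ERROR BAR (ceiling-free, any model density)**: for `N ≥ 2`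
independent proposals, `Var[Û] ≤ (N + 1)/(N(N − 1))` (through the sharp
`4a(1 − a)/N + 2(1 − a²)/(N(N − 1))` of `AllPairsVariance.variance_allPairs_le_sharp'`). [ours] -/
theorem phi4Flow_variance_allPairs_le {lam : ℝ} (hlam : 0 < lam)
    (J : Fin (m + 1) → Fin (m + 1) → ℝ) {q : (Fin (m + 1) → ℝ) → ℝ} (hq0 : ∀ φ, 0 < q φ)
    (hqm : Measurable q) (hqi : Integrable q) (hq1 : ∫ φ, q φ = 1)
    {x : Fin N → Ω → (Fin (m + 1) → ℝ)} (hxm : ∀ i, Measurable (x i)) (hind : iIndepFun x P)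
    (hlaw : ∀ i, Measure.map (x i) P = volume.withDensity fun φ => ENNReal.ofReal (q φ))
    (hN : 2 ≤ N) :
    Var[fun ω => (∑ z ∈ (univ : Finset (Fin N)).offDiag,
        min (gibbsWeight J lam (x z.1 ω) / (∫ ψ, gibbsWeight J lam ψ) / q (x z.1 ω))
          (gibbsWeight J lam (x z.2 ω) / (∫ ψ, gibbsWeight J lam ψ) / q (x z.2 ω)))
        / (N * (N - 1) : ℝ); P]
      ≤ (N + 1) / (N * (N - 1)) := by
  obtain ⟨-, hp0, hpm, hpi, hp1⟩ := phi4Target_normalised hlam J hq1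
  obtain ⟨h1, h2⟩ := AllPairsVariance.variance_allPairs_le_sharp' (μ := volume) hxm hind hp0 hpm
    hpi hp1 hq0 hqm hqi hlaw hN
  exact h1.trans h2

/-- **φ⁴ FLOW, CHEBYSHEV FOR THE ALL-PAIRS ACCEPTANCE ESTIMATE**: for `N ≥ 2` independent
proposals and `t > 0`, `P(|Û − a| ≥ t) ≤ (N + 1)/(N(N − 1)t²)`. [ours] -/
theorem phi4Flow_chebyshev_allPairs {lam : ℝ} (hlam : 0 < lam)
    (J : Fin (m + 1) → Fin (m + 1) → ℝ) {q : (Fin (m + 1) → ℝ) → ℝ} (hq0 : ∀ φ, 0 < q φ)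
    (hqm : Measurable q) (hqi : Integrable q) (hq1 : ∫ φ, q φ = 1)
    {x : Fin N → Ω → (Fin (m + 1) → ℝ)} (hxm : ∀ i, Measurable (x i)) (hind : iIndepFun x P)
    (hlaw : ∀ i, Measure.map (x i) P = volume.withDensity fun φ => ENNReal.ofReal (q φ))
    (hN : 2 ≤ N) {t : ℝ} (ht : 0 < t) :
    P.real {ω | t ≤ |(∑ z ∈ (univ : Finset (Fin N)).offDiag,
        min (gibbsWeight J lam (x z.1 ω) / (∫ ψ, gibbsWeight J lam ψ) / q (x z.1 ω))
          (gibbsWeight J lam (x z.2 ω) / (∫ ψ, gibbsWeight J lam ψ) / q (x z.2 ω)))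
        / (N * (N - 1))
          - ∫ φ, ∫ φ', min (gibbsWeight J lam φ / (∫ ψ, gibbsWeight J lam ψ) * q φ')
              (gibbsWeight J lam φ' / (∫ ψ, gibbsWeight J lam ψ) * q φ)|}
      ≤ (N + 1) / (N * (N - 1)) / t ^ 2 := by
  obtain ⟨-, hp0, hpm, hpi, hp1⟩ := phi4Target_normalised hlam J hq1
  exact AllPairsVariance.chebyshev_allPairs_sharp_real (μ := volume) hxm hind hp0 hpm hpi hp1 hq0
    hqm hqi hlaw hN ht

/-- **φ⁴ FLOW, THE PRINTED ACCEPTANCE MONITOR**: if moreover `W₂ = ∫ (e^{−S}/q̃)e^{−S} < ∞`, then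
for `N ≥ 2` independent proposals, `t > 0`, `0 < s < 1`: the model probability that
`acc_est = Σ_{i≠j} min(w_i, w_j)/((N − 1)Σ_i w_i)` misses `a` by `(t + s)/(1 − s)` or more is
at most `(N + 1)/(N(N − 1)t²) + (W₂/Z² − 1)/(N s²)`. [ours] -/
theorem phi4Flow_accMonitor_concentration {lam : ℝ} (hlam : 0 < lam)
    (J : Fin (m + 1) → Fin (m + 1) → ℝ) {q : (Fin (m + 1) → ℝ) → ℝ} (hq0 : ∀ φ, 0 < q φ)
    (hqm : Measurable q) (hqi : Integrable q) (hq1 : ∫ φ, q φ = 1)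
    (hW₂ : Integrable (fun φ => gibbsWeight J lam φ / q φ * gibbsWeight J lam φ))
    {x : Fin N → Ω → (Fin (m + 1) → ℝ)} (hxm : ∀ i, Measurable (x i)) (hind : iIndepFun x P)
    (hlaw : ∀ i, Measure.map (x i) P = volume.withDensity fun φ => ENNReal.ofReal (q φ))
    (hN : 2 ≤ N) {t s : ℝ} (ht : 0 < t) (hs : 0 < s) (hs1 : s < 1) :
    P.real {ω | (t + s) / (1 - s) ≤
        |(∑ i, ∑ j ∈ univ.erase i,
            min (gibbsWeight J lam (x i ω) / (∫ ψ, gibbsWeight J lam ψ) / q (x i ω))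
              (gibbsWeight J lam (x j ω) / (∫ ψ, gibbsWeight J lam ψ) / q (x j ω)))
            / ((N - 1) * ∑ i, gibbsWeight J lam (x i ω) / (∫ ψ, gibbsWeight J lam ψ) / q (x i ω))
          - ∫ φ, ∫ φ', min (gibbsWeight J lam φ / (∫ ψ, gibbsWeight J lam ψ) * q φ')
              (gibbsWeight J lam φ' / (∫ ψ, gibbsWeight J lam ψ) * q φ)|}
      ≤ (N + 1) / (N * (N - 1)) / t ^ 2
        + ((∫ φ, gibbsWeight J lam φ / q φ * gibbsWeight J lam φ) / (∫ ψ, gibbsWeight J lam ψ) ^ 2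
            - 1) / (N * s ^ 2) := by
  obtain ⟨hZ, hp0, hpm, hpi, hp1⟩ := phi4Target_normalised hlam J hq1
  set Z := ∫ ψ, gibbsWeight J lam ψ with hZdef
  -- the second weight moment of `p = e^{−S}/Z` is `W₂/Z²`
  have e : ∀ φ, gibbsWeight J lam φ / Z / q φ * (gibbsWeight J lam φ / Z)
      = gibbsWeight J lam φ / q φ * gibbsWeight J lam φ / Z ^ 2 := fun φ => by
    have hq := (hq0 φ).ne'
    field_simp
  have hW : Integrable (fun φ => gibbsWeight J lam φ / Z / q φ * (gibbsWeight J lam φ / Z)) := by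
    simp_rw [e]
    exact hW₂.div_const _
  have hWval : ∫ φ, gibbsWeight J lam φ / Z / q φ * (gibbsWeight J lam φ / Z)
      = (∫ φ, gibbsWeight J lam φ / q φ * gibbsWeight J lam φ) / Z ^ 2 := by
    simp_rw [e]
    rw [integral_div]
  have hw2 : MemLp (fun φ => gibbsWeight J lam φ / Z / q φ) 2
      (volume.withDensity fun φ => ENNReal.ofReal (q φ)) :=
    (AllPairsVariance.memLp_weight_two_iff (μ := volume) hpm hq0 hqm).2 hW
  have h := AllPairsVariance.accMonitor_concentration_iid (μ := volume) hxm hind hp0 hpm hpi hp1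
    hq0 hqm hqi hw2 hlaw hN ht hs hs1
  rw [AllPairsVariance.integral_weightVar_eq (μ := volume) hpi hp1 hq0 hqi hq1 hW, hWval] at h
  exact h

end Phi4

end Summit.Ventures.LatticeQCDFlow.Scoring
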